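import Literature.MathematicalPhysics.QuantumFieldTheory.Balaban1983to89.B8CubeMemberTorusChart
import Literature.MathematicalPhysics.QuantumFieldTheory.Balaban1983to89.B8Ineq159FlatCubeMemberPrinted

/-!
# `Balaban1983to89.B8FlatOperatorsTranslateLocal` — THE FLAT `U₀ = 1` OPERATORS OF [Balaban1985RegularSpaces] §1 ON `ℤ^{d+1}`: TRANSLATION INVARIANCE OF
# `D^η_1`, `D^η_1` on plaquettes, `J = D^{η*}_1D^η_1`, `Δ^η_1`; A LOCAL BOUND `|J(φ)_μ(x)| ≤ 16(d+1)η⁻²·sup_{stencil}|φ|`; PLAQUETTE-SIDE GEOMETRY (`SideTouches S` ⇒ within one of `S`)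

statement-level skeleton of published theorems with citation tags; proofs where landed; nothing here is a claim about the
Yang–Mills mass gap

CITATION HEADER (lean-in-tree rule).  Cell `pub-ymgap` (YM Track A, HUMAN RULING D-0062), DAG node N05 = [B8], seat `pub-ymgap-dag-n05-c` (g12), `TRANSPLANT-DESIGN.md` step T4
(part 1 of 3: the field-side plumbing of the transplant `B8Ineq159FlatCubeMemberTransplant`).  Elementary finite algebra on `ℤ^{d+1}` (dictionary ∕ folklore);
count-neutral; nothing continuum ∕ ℝ⁴ ∕ OS ∕ mass-gap ∕ Clay.  Unit `pub-ymgap-dag-n05-c` (g12), 2026-08-28.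
-/
noncomputable section

namespace Literature.MathematicalPhysics.QuantumFieldTheory.Balaban1983to89.B8FlatOperatorsTranslateLocal

open B7Prop1Explicit (e e_apply)
open B7Prop1Local (InBox)
open B8Ineq132 (covDerivFwd covDeriv BondTouches PlaqTouches)
open B8Eq146AExpansion (plaqCovDeriv iEta)
open B8Eq155JBound (Jcur)
open B8Eq138LandauZd (covLap covDivB)
open B8Eq140Level (SideTouches IsSide)
open B8Eq191FlatStencils (covDerivFwd_flat_apply covDeriv_flat_apply covLap_flat_apply conjR_unitOne)

variable {d : ℕ}

/-! ## §1 Translation invariance of the flat operators -/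

section Translate

variable (η : ℝ) (φ : (Fin (d + 1) → ℤ) → Fin (d + 1) → ℂ) (t : Fin (d + 1) → ℤ)

/-- `D^η_{1,ν}` commutes with translations. [cite: Balaban1985RegularSpaces, (1.1) p.76, dictionary] -/
theorem covDerivFwd_one_translate (ν τ : Fin (d + 1)) (x : Fin (d + 1) → ℤ) :
    covDerivFwd η (1 : (Fin (d + 1) → ℤ) → Fin (d + 1) → ℂˣ) ν (fun z => φ (z - t) τ) x =
      covDerivFwd η (1 : (Fin (d + 1) → ℤ) → Fin (d + 1) → ℂˣ) ν (fun z => φ z τ) (x - t) := by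
  rw [covDerivFwd_flat_apply, covDerivFwd_flat_apply, add_sub_right_comm]

/-- `D^η_1` on plaquettes commutes with translations. [cite: Balaban1985BackgroundPropagators, (3.4) p.391, dictionary] -/
theorem plaqCovDeriv_one_translate (μ ν : Fin (d + 1)) (x : Fin (d + 1) → ℤ) :
    plaqCovDeriv η (1 : (Fin (d + 1) → ℤ) → Fin (d + 1) → ℂˣ) (fun z => φ (z - t)) μ ν x =
      plaqCovDeriv η (1 : (Fin (d + 1) → ℤ) → Fin (d + 1) → ℂˣ) φ μ ν (x - t) := by
  simp only [plaqCovDeriv, B8Eq146AExpansion.lin, B8Eq146AExpansion.X1, B8Eq146AExpansion.X2, B8Eq146AExpansion.X3, B8Eq146AExpansion.X4,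
    Pi.one_apply, conjR_unitOne, add_sub_right_comm]

/-- `J = D^{η*}_1D^η_1` commutes with translations. [cite: Balaban1985RegularSpaces, (1.55) p.86, (1.2) p.76, dictionary] -/
theorem Jcur_one_translate (μ : Fin (d + 1)) (x : Fin (d + 1) → ℤ) :
    Jcur η (1 : (Fin (d + 1) → ℤ) → Fin (d + 1) → ℂˣ) (fun z => φ (z - t)) μ x =
      Jcur η (1 : (Fin (d + 1) → ℤ) → Fin (d + 1) → ℂˣ) φ μ (x - t) := by
  have hF : plaqCovDeriv η (1 : (Fin (d + 1) → ℤ) → Fin (d + 1) → ℂˣ) (fun z => φ (z - t)) =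
      fun a b z => plaqCovDeriv η (1 : (Fin (d + 1) → ℤ) → Fin (d + 1) → ℂˣ) φ a b (z - t) := by
    funext a b z; exact plaqCovDeriv_one_translate η φ t a b z
  rw [B8Eq155JBound.Jcur_def, B8Eq155JBound.Jcur_def, hF]
  simp only [B8Eq143PlaqExpansion.pdiv, covDeriv_flat_apply, sub_right_comm _ (e _) t]

/-- `Δ^η_1` commutes with translations. [cite: Balaban1985BackgroundPropagators, (3.23) p.394, dictionary] -/
theorem covLap_one_translate (f : (Fin (d + 1) → ℤ) → ℂ) (x : Fin (d + 1) → ℤ) :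
    covLap η (1 : (Fin (d + 1) → ℤ) → Fin (d + 1) → ℂˣ) (fun z => f (z - t)) x = covLap η (1 : (Fin (d + 1) → ℤ) → Fin (d + 1) → ℂˣ) f (x - t) := by
  rw [covLap_flat_apply, covLap_flat_apply]
  simp only [add_sub_right_comm, sub_right_comm _ (e _) t]

end Translate

/-! ## §2 A local bound for `J` -/

section LocalJ

/-- **`|J(φ)_μ(x)| ≤ 16(d+1)η⁻²·K` IF `|φ| ≤ K` ON THE STENCIL** (all bonds `⟨y, τ⟩` with `|y − x|_∞ ≤ 1`): `J = D^{η*}_1D^η_1φ` is a double difference with at most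
`2(d+1)` first differences of the four-term plaquette derivative. [cite: Balaban1985RegularSpaces, (1.2) p.76, (1.55) p.86; Balaban1985BackgroundPropagators, (3.4) p.391] -/
theorem norm_Jcur_one_le_of_near {η : ℝ} (hη : 0 < η) {φ : (Fin (d + 1) → ℤ) → Fin (d + 1) → ℂ} {x : Fin (d + 1) → ℤ} {K : ℝ} (hK : 0 ≤ K)
    (hφ : ∀ (y : Fin (d + 1) → ℤ) (τ : Fin (d + 1)), (∀ i, |y i - x i| ≤ 1) → ‖φ y τ‖ ≤ K) (μ : Fin (d + 1)) :
    ‖Jcur η (1 : (Fin (d + 1) → ℤ) → Fin (d + 1) → ℂˣ) φ μ x‖ ≤ 16 * ((d : ℝ) + 1) * (η ^ 2)⁻¹ * K := by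
  have hη0 : 0 ≤ η⁻¹ := inv_nonneg.2 hη.le
  -- the plaquette derivative at `x` and at `x − e_ν` is bounded by `4η⁻¹K`
  have hP : ∀ (a b ν : Fin (d + 1)) (z : Fin (d + 1) → ℤ), (z = x ∨ z = x - e ν) →
      ‖plaqCovDeriv η (1 : (Fin (d + 1) → ℤ) → Fin (d + 1) → ℂˣ) φ a b z‖ ≤ η⁻¹ * (4 * K) := by
    intro a b ν z hz
    have hnear : ∀ (v : Fin (d + 1) → ℤ), (∀ i, 0 ≤ v i ∧ v i ≤ 1) → ∀ τ, ‖φ (z + v) τ‖ ≤ K := by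
      intro v hv τ
      refine hφ _ τ fun i => ?_
      rcases hz with rfl | rfl
      · simp only [Pi.add_apply, add_sub_cancel_left]; exact abs_le.2 ⟨by linarith [(hv i).1], (hv i).2⟩
      · simp only [Pi.add_apply, Pi.sub_apply, e_apply]
        have := hv i
        split_ifs <;> (rw [abs_le]; constructor <;> linarith [this.1, this.2])
    have h0 : ∀ τ, ‖φ z τ‖ ≤ K := fun τ => by simpa using hnear 0 (fun i => by simp) τ
    have h1 : ∀ κ τ, ‖φ (z + e κ) τ‖ ≤ K := fun κ τ => hnear (e κ) (fun i => by rw [e_apply]; split_ifs <;> simp) τ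
    simp only [plaqCovDeriv, B8Eq146AExpansion.lin, B8Eq146AExpansion.X1, B8Eq146AExpansion.X2, B8Eq146AExpansion.X3, B8Eq146AExpansion.X4,
      Pi.one_apply, conjR_unitOne, norm_smul, Real.norm_of_nonneg hη0]
    refine mul_le_mul_of_nonneg_left ?_ hη0
    calc ‖φ z a + φ (z + e a) b + -φ (z + e b) a + -φ z b‖
        ≤ ‖φ z a‖ + ‖φ (z + e a) b‖ + ‖-φ (z + e b) a‖ + ‖-φ z b‖ := by
          refine (norm_add_le _ _).trans (add_le_add ((norm_add_le _ _).trans (add_le_add (norm_add_le _ _) le_rfl)) le_rfl)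
      _ ≤ K + K + K + K := by rw [norm_neg, norm_neg]; exact add_le_add (add_le_add (add_le_add (h0 a) (h1 a b)) (h1 b a)) (h0 b)
      _ = 4 * K := by ring
  -- each backward difference of it is bounded by `8η⁻²K`
  have hD : ∀ (a b ν : Fin (d + 1)),
      ‖covDeriv η (1 : (Fin (d + 1) → ℤ) → Fin (d + 1) → ℂˣ) ν (plaqCovDeriv η (1 : (Fin (d + 1) → ℤ) → Fin (d + 1) → ℂˣ) φ a b) x‖ ≤ 8 * (η ^ 2)⁻¹ * K := by
    intro a b ν
    rw [covDeriv_flat_apply, norm_smul, Real.norm_of_nonneg hη0]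
    calc η⁻¹ * ‖plaqCovDeriv η 1 φ a b (x - e ν) - plaqCovDeriv η 1 φ a b x‖
        ≤ η⁻¹ * (η⁻¹ * (4 * K) + η⁻¹ * (4 * K)) :=
          mul_le_mul_of_nonneg_left ((norm_sub_le _ _).trans (add_le_add (hP a b ν _ (Or.inr rfl)) (hP a b ν _ (Or.inl rfl)))) hη0
      _ = 8 * (η ^ 2)⁻¹ * K := by rw [pow_two, mul_inv]; ring
  rw [B8Eq155JBound.Jcur_def, B8Eq143PlaqExpansion.pdiv]
  have hsum : ∀ (s : Finset (Fin (d + 1))) (F : Fin (d + 1) → ℂ), (∀ ν, ‖F ν‖ ≤ 8 * (η ^ 2)⁻¹ * K) →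
      ‖∑ ν ∈ s, F ν‖ ≤ ((d : ℝ) + 1) * (8 * (η ^ 2)⁻¹ * K) := by
    intro s F hF
    calc ‖∑ ν ∈ s, F ν‖ ≤ ∑ ν ∈ s, ‖F ν‖ := norm_sum_le _ _
      _ ≤ ∑ _ν ∈ s, 8 * (η ^ 2)⁻¹ * K := Finset.sum_le_sum fun ν _ => hF ν
      _ = s.card * (8 * (η ^ 2)⁻¹ * K) := by rw [Finset.sum_const, nsmul_eq_mul]
      _ ≤ ((d : ℝ) + 1) * (8 * (η ^ 2)⁻¹ * K) := by
          refine mul_le_mul_of_nonneg_right ?_ (by positivity)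
          have : s.card ≤ d + 1 := by simpa using Finset.card_le_univ s
          exact_mod_cast this
  calc ‖(∑ ν ∈ Finset.Iio μ, covDeriv η 1 ν (plaqCovDeriv η 1 φ ν μ) x) - ∑ ν ∈ Finset.Ioi μ, covDeriv η 1 ν (plaqCovDeriv η 1 φ μ ν) x‖
      ≤ ‖∑ ν ∈ Finset.Iio μ, covDeriv η 1 ν (plaqCovDeriv η 1 φ ν μ) x‖ + ‖∑ ν ∈ Finset.Ioi μ, covDeriv η 1 ν (plaqCovDeriv η 1 φ μ ν) x‖ :=
        norm_sub_le _ _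
    _ ≤ ((d : ℝ) + 1) * (8 * (η ^ 2)⁻¹ * K) + ((d : ℝ) + 1) * (8 * (η ^ 2)⁻¹ * K) :=
        add_le_add (hsum _ _ fun ν => hD ν μ ν) (hsum _ _ fun ν => hD μ ν ν)
    _ = 16 * ((d : ℝ) + 1) * (η ^ 2)⁻¹ * K := by ring

end LocalJ

/-! ## §3 Plaquette-side geometry: a side of a plaquette touching `S` is within sup-distance one of `S` -/

section Sides

/-- two corners of one unit plaquette differ by at most one in every coordinate (private plumbing). [cite: Balaban1985RegularSpaces, (1.2) p.76, dictionary] -/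
private theorem corner_close (z : Fin (d + 1) → ℤ) {κ ν : Fin (d + 1)} (hκν : κ ≠ ν) (p q p' q' : Bool) (i : Fin (d + 1)) :
    |(z + (if p then e κ else 0) + (if q then e ν else 0)) i - (z + (if p' then e κ else 0) + (if q' then e ν else 0)) i| ≤ 1 := by
  simp only [Pi.add_apply]
  have hκ : ∀ b : Bool, ((if b then e κ else (0 : Fin (d + 1) → ℤ)) i) = if b ∧ i = κ then 1 else 0 := by
    intro b; cases b <;> simp [e_apply]
  have hν : ∀ b : Bool, ((if b then e ν else (0 : Fin (d + 1) → ℤ)) i) = if b ∧ i = ν then 1 else 0 := by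
    intro b; cases b <;> simp [e_apply]
  rw [hκ, hκ, hν, hν]
  by_cases hiκ : i = κ
  · have hiν : i ≠ ν := fun h => hκν (hiκ ▸ h)
    cases p <;> cases p' <;> cases q <;> cases q' <;> simp [hiκ, hκν]
  · by_cases hiν : i = ν
    · cases p <;> cases p' <;> cases q <;> cases q' <;> simp [hiν, Ne.symm hκν]
    · simp [hiκ, hiν]

/-- **BOTH ENDS OF A SIDE OF A PLAQUETTE TOUCHING `S` ARE WITHIN SUP-DISTANCE ONE OF `S`**. [cite: Balaban1985RegularSpaces, p.77 (convention before (1.5)), (1.2) p.76] -/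
theorem near_of_sideTouches {S : Set (Fin (d + 1) → ℤ)} {y : Fin (d + 1) → ℤ} {τ : Fin (d + 1)} (h : SideTouches S y τ) :
    (∃ s ∈ S, ∀ i, |y i - s i| ≤ 1) ∧ (∃ s ∈ S, ∀ i, |(y + e τ) i - s i| ≤ 1) := by
  obtain ⟨z, κ, ν, hκν, hpl, hside⟩ := h
  -- every corner is `z + [p]e_κ + [q]e_ν`
  have hcorner : ∀ w : Fin (d + 1) → ℤ, (w = z ∨ w = z + e κ ∨ w = z + e ν ∨ w = z + e κ + e ν) →
      ∃ p q : Bool, w = z + (if p then e κ else 0) + (if q then e ν else 0) := by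
    rintro w (rfl | rfl | rfl | rfl)
    · exact ⟨false, false, by simp⟩
    · exact ⟨true, false, by simp⟩
    · exact ⟨false, true, by simp⟩
    · exact ⟨true, true, by simp⟩
  -- a corner in `S`
  have hS : ∃ s ∈ S, ∃ p q : Bool, s = z + (if p then e κ else 0) + (if q then e ν else 0) := by
    rcases hpl with h1 | h2 | h3 | h4
    · exact ⟨_, h1, hcorner _ (Or.inl rfl)⟩
    · exact ⟨_, h2, hcorner _ (Or.inr (Or.inl rfl))⟩
    · exact ⟨_, h3, hcorner _ (Or.inr (Or.inr (Or.inl rfl)))⟩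
    · exact ⟨_, h4, hcorner _ (Or.inr (Or.inr (Or.inr rfl)))⟩
  obtain ⟨s, hsS, p', q', hs⟩ := hS
  -- the two ends of the side are corners
  have hy : ∃ p q : Bool, y = z + (if p then e κ else 0) + (if q then e ν else 0) := by
    rcases hside with ⟨rfl, -⟩ | ⟨rfl, -⟩ | ⟨rfl, -⟩ | ⟨rfl, -⟩
    · exact hcorner _ (Or.inl rfl)
    · exact hcorner _ (Or.inr (Or.inl rfl))
    · exact hcorner _ (Or.inr (Or.inr (Or.inl rfl)))
    · exact hcorner _ (Or.inl rfl)
  have hy' : ∃ p q : Bool, y + e τ = z + (if p then e κ else 0) + (if q then e ν else 0) := by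
    rcases hside with ⟨rfl, rfl⟩ | ⟨rfl, rfl⟩ | ⟨rfl, rfl⟩ | ⟨rfl, rfl⟩
    · exact ⟨true, false, by simp⟩
    · exact ⟨true, true, by simp [add_assoc]⟩
    · exact ⟨true, true, by simp [add_assoc, add_comm (e ν)]⟩
    · exact ⟨false, true, by simp⟩
  obtain ⟨p, q, hyq⟩ := hy
  obtain ⟨p₂, q₂, hyq₂⟩ := hy'
  exact ⟨⟨s, hsS, fun i => by rw [hyq, hs]; exact corner_close z hκν p q p' q' i⟩,
    ⟨s, hsS, fun i => by rw [hyq₂, hs]; exact corner_close z hκν p₂ q₂ p' q' i⟩⟩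

end Sides

end Literature.MathematicalPhysics.QuantumFieldTheory.Balaban1983to89.B8FlatOperatorsTranslateLocal
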